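import Literature.MathematicalPhysics.QuantumFieldTheory.ConformalBootstrap3D.MixedHeadBound

/-!
# Mixed `σ–ε` point certificates: the table theorem with bound cells (v2)

`boxExcluded_of_mixedPointTable` (`MixedPointTable`) is correct but asks every light-block cell of a
spinning row to start STRICTLY above the unitarity bound while the row must start at `≤ ℓ + 1 =
unitarityBound3D ℓ` — jointly unsatisfiable for `ℓ + 1 < E₀`, so that theorem can only be
instantiated with `E₀ ≤ 2`. This v2 gives each cell of the scalar / even-spin / odd-spin rows a RULE
TAG: the INTERVAL rule (as before: `unitarityBound3D ℓ < t`, `ℓ + τ ≤ t`, interval-table numbers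
`evenHeadX/Y/Z`, `oddHeadNumber`) or the BOUND rule of `MixedHeadBound` (spinning rows only:
`ℓ + 1 ≤ t`, monotone-table numbers `evenHeadXM/YM/ZM`, resp. for `ℓ ≥ 1` the bound-table number
`oddHeadNumberBd` of the rescaled head `(Δ-ℓ-1)·𝔇[gpm]`), encoded as a disjunction per cell. With
the first cell of each spinning row under the bound rule the hypotheses are satisfiable for any
`E₀`, and the conclusion is again `BoxExcluded Q`; together with `isingEnclosure_of_grid` this is the
complete Lean-shaped checker of a MIXED island certificate made of point functionals (relaxed odd
constraint, see `MixedOddTail`). [cite: KosPolandSimmonsduffin2014, §3.3 eq. (3.16)]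
-/

noncomputable section

namespace Literature.MathematicalPhysics.QuantumFieldTheory.ConformalBootstrap3D

open Finset Set Filter Topology

/-- **Exclusion of a box `Q` of `(Δ_σ, Δ_ε)` from a finite table of numbers — v2 with bound cells.**
As `boxExcluded_of_mixedPointTable`, except that each cell of the rows `te ℓ ·` (even sector,
`ℓ = 0` scalar row and even `0 < ℓ < L`) and `td ℓ ·` (odd sector, all `ℓ < L`) carries EITHER the
interval-rule data (`unitarityBound3D ℓ < t ℓ k`, `ℓ + τ ≤ t ℓ k`, interval numbers) OR — spinning rows
only — the bound-rule data (`ℓ + 1 ≤ t ℓ k`, monotone / bound-table numbers); the `ε`-row, `σ`-row,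
(M)/(T) data and the identity number are unchanged. CONCLUSION: `BoxExcluded Q`.
[cite: KosPolandSimmonsduffin2014, §3.3 eq. (3.16)] -/
theorem boxExcluded_of_mixedPointTable₂ {N : ℕ} {z zb : Fin N → ℝ} {w : Fin 5 → Fin N → ℝ}
    (hz : ∀ k, z k ∈ Ioo (0 : ℝ) 1) (hzb : ∀ k, zb k ∈ Ioo (0 : ℝ) 1) (hord : ∀ k, zb k ≤ z k)
    (a₀ : Fin N) (qd qr : Fin N → ℝ) (hqd : ∀ k, 0 < qd k ∧ qd k ≤ 1)
    (hqr : ∀ k, 0 < qr k ∧ qr k ≤ 1)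
    (hdomd : ∀ k, z k * zb k ≤ qd k ^ 2 * (z a₀ * zb a₀) ∧ z k ≤ qd k * z a₀)
    (hdomr : ∀ k, (1 - z k) * (1 - zb k) ≤ qr k ^ 2 * (z a₀ * zb a₀) ∧ 1 - zb k ≤ qr k * z a₀)
    {Q : Set (ℝ × ℝ)} {σlo σhi εlo εhi c₁ c₂ E₀ ET τ : ℝ}
    (hQ : ∀ p ∈ Q, (σlo ≤ p.1 ∧ p.1 ≤ σhi) ∧ (εlo ≤ p.2 ∧ p.2 ≤ εhi))
    (hQc : ∀ p ∈ Q, c₁ ≤ (p.1 - p.2) / 2 ∧ (p.1 - p.2) / 2 ≤ c₂)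
    (hτ1 : τ ≤ 1) (hτ0 : τ ≤ E₀) (hE1 : 1 < E₀) (L : ℕ) (hL : E₀ ≤ (L : ℝ) + 1)
    -- (I)
    (hI : 0 < termCornerBound (w 0) z zb 0 0 0 σlo σhi + termCornerBound (w 1) z zb 0 0 0 εlo εhi +
      cornerBound₂ (w 3 + w 4) (w 3 - w 4) z zb 0 0 0 ((σlo + εlo) / 2) ((σhi + εhi) / 2))
    -- EVEN CELLS: ε-row, scalar + even-spin rows
    (tε : ℕ → ℝ) (Kε : ℕ) (nFε : ℕ → ℕ) (htε : tε 0 ≤ εlo ∧ εhi < tε Kε)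
    (hlowε : ∀ k, k < Kε → 1 / 2 < tε k ∧ τ ≤ tε k)
    (hnFε : ∀ k, k < Kε → E₀ ≤ tε k + ((nFε k : ℝ) + 1))
    (hcellε : ∀ k, k < Kε → 0 ≤ evenHeadX z zb w 0 (tε k) (tε (k + 1)) σlo σhi (nFε k) ∧
      0 ≤ evenHeadY z zb w 0 (tε k) (tε (k + 1)) εlo εhi (nFε k) ∧
      evenHeadZ z zb w 0 (tε k) (tε (k + 1)) σlo σhi εlo εhi (nFε k) ^ 2 ≤
        4 * evenHeadX z zb w 0 (tε k) (tε (k + 1)) σlo σhi (nFε k) *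
          evenHeadY z zb w 0 (tε k) (tε (k + 1)) εlo εhi (nFε k))
    (te : ℕ → ℕ → ℝ) (Ke : ℕ → ℕ) (nFe : ℕ → ℕ → ℕ)
    (hte0 : te 0 0 ≤ 3 ∧ te 0 (Ke 0) = E₀)
    (hteℓ : ∀ ℓ, Even ℓ → ℓ ≠ 0 → ℓ < L → te ℓ 0 ≤ (ℓ : ℝ) + 1 ∧ te ℓ (Ke ℓ) = E₀)
    (hnFe : ∀ ℓ k, k < Ke ℓ → E₀ ≤ te ℓ k + ((nFe ℓ k : ℝ) + 1))
    (hcelle : ∀ ℓ, (ℓ = 0 ∨ (Even ℓ ∧ ℓ < L)) → ∀ k, k < Ke ℓ →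
      -- interval rule: the cell starts strictly above the bound and at `≥ ℓ + τ`
      (unitarityBound3D ℓ < te ℓ k ∧ (ℓ : ℝ) + τ ≤ te ℓ k ∧
        0 ≤ evenHeadX z zb w ℓ (te ℓ k) (te ℓ (k + 1)) σlo σhi (nFe ℓ k) ∧
        0 ≤ evenHeadY z zb w ℓ (te ℓ k) (te ℓ (k + 1)) εlo εhi (nFe ℓ k) ∧
        evenHeadZ z zb w ℓ (te ℓ k) (te ℓ (k + 1)) σlo σhi εlo εhi (nFe ℓ k) ^ 2 ≤
          4 * evenHeadX z zb w ℓ (te ℓ k) (te ℓ (k + 1)) σlo σhi (nFe ℓ k) *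
            evenHeadY z zb w ℓ (te ℓ k) (te ℓ (k + 1)) εlo εhi (nFe ℓ k)) ∨
      -- bound rule (spinning rows): the cell starts at `≥ ℓ + 1`, monotone-table numbers
      (ℓ ≠ 0 ∧ (ℓ : ℝ) + 1 ≤ te ℓ k ∧
        0 ≤ evenHeadXM z zb w ℓ (te ℓ k) (te ℓ (k + 1)) σlo σhi (nFe ℓ k) ∧
        0 ≤ evenHeadYM z zb w ℓ (te ℓ k) (te ℓ (k + 1)) εlo εhi (nFe ℓ k) ∧
        evenHeadZM z zb w ℓ (te ℓ k) (te ℓ (k + 1)) σlo σhi εlo εhi (nFe ℓ k) ^ 2 ≤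
          4 * evenHeadXM z zb w ℓ (te ℓ k) (te ℓ (k + 1)) σlo σhi (nFe ℓ k) *
            evenHeadYM z zb w ℓ (te ℓ k) (te ℓ (k + 1)) εlo εhi (nFe ℓ k)))
    -- EVEN (M) box rows and (T)
    (ee : ℕ → ℕ → ℝ) (Me : ℕ → ℕ)
    (hee : ∀ j : ℕ, (j : ℝ) + τ < ET → ee j 0 ≤ max E₀ ((j : ℝ) + τ) ∧ ET ≤ ee j (Me j))
    (hboxe : ∀ j : ℕ, (j : ℝ) + τ < ET → ∀ m < Me j,
      0 ≤ termCornerBound (w 0) z zb j (ee j m) (ee j (m + 1)) σlo σhi ∧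
      0 ≤ termCornerBound (w 1) z zb j (ee j m) (ee j (m + 1)) εlo εhi ∧
      offDiagTermAbs z zb w j (ee j m) (ee j (m + 1)) ((σlo + εlo) / 2) ((σhi + εhi) / 2) ^ 2 ≤
        4 * termCornerBound (w 0) z zb j (ee j m) (ee j (m + 1)) σlo σhi *
          termCornerBound (w 1) z zb j (ee j m) (ee j (m + 1)) εlo εhi)
    (h0 : 0 ≤ w 0 a₀) (h1 : 0 ≤ w 1 a₀)
    (hX0 : 0 ≤ w 0 a₀ * ((1 - z a₀) * (1 - zb a₀)) ^ σhi - apexRest (w 0) z zb a₀ qd qr σlo ET)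
    (hY0 : 0 ≤ w 1 a₀ * ((1 - z a₀) * (1 - zb a₀)) ^ εhi - apexRest (w 1) z zb a₀ qd qr εlo ET)
    (hZ0 : (|w 3 a₀ + w 4 a₀| * ((1 - z a₀) * (1 - zb a₀)) ^ ((σlo + εlo) / 2)
            + apexRest (w 3) z zb a₀ qd qr ((σlo + εlo) / 2) ET
            + apexRest (w 4) z zb a₀ qd qr ((σlo + εlo) / 2) ET) ^ 2 ≤
        4 * (w 0 a₀ * ((1 - z a₀) * (1 - zb a₀)) ^ σhi - apexRest (w 0) z zb a₀ qd qr σlo ET) *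
          (w 1 a₀ * ((1 - z a₀) * (1 - zb a₀)) ^ εhi - apexRest (w 1) z zb a₀ qd qr εlo ET))
    -- ODD CELLS: σ-row, scalar + all-spin rows
    (tσ : ℕ → ℝ) (Kσ : ℕ) (nFσ : ℕ → ℕ) (htσ : tσ 0 ≤ σlo ∧ σhi < tσ Kσ)
    (hlowσ : ∀ k, k < Kσ → 1 / 2 < tσ k ∧ τ ≤ tσ k ∧ tσ (k + 1) ≤ 1)
    (hnFσ : ∀ k, k < Kσ → E₀ ≤ tσ k + ((nFσ k : ℝ) + 1))
    (hcellσ : ∀ k, k < Kσ → 0 ≤ oddHeadNumber z zb w 0 c₁ c₂ (tσ k) (tσ (k + 1)) σlo σhi (nFσ k))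
    (td : ℕ → ℕ → ℝ) (Ko : ℕ → ℕ) (nFo : ℕ → ℕ → ℕ)
    (htd0 : td 0 0 ≤ 3 ∧ td 0 (Ko 0) = E₀ ∧ 1 < td 0 0)
    (htdℓ : ∀ ℓ, ℓ ≠ 0 → ℓ < L → td ℓ 0 ≤ (ℓ : ℝ) + 1 ∧ td ℓ (Ko ℓ) = E₀)
    (hnFo : ∀ ℓ k, k < Ko ℓ → E₀ ≤ td ℓ k + ((nFo ℓ k : ℝ) + 1))
    (hcello : ∀ ℓ, ℓ < L → ∀ k, k < Ko ℓ →
      -- interval rule: strictly above the bound, `≥ ℓ + τ`, not before the row start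
      (unitarityBound3D ℓ < td ℓ k ∧ (ℓ : ℝ) + τ ≤ td ℓ k ∧ td ℓ 0 ≤ td ℓ k ∧
        0 ≤ oddHeadNumber z zb w ℓ c₁ c₂ (td ℓ k) (td ℓ (k + 1)) σlo σhi (nFo ℓ k)) ∨
      -- bound rule (spinning rows `ℓ ≥ 1`): the cell starts at `≥ ℓ + 1`, bound-table number
      (1 ≤ ℓ ∧ (ℓ : ℝ) + 1 ≤ td ℓ k ∧
        0 ≤ oddHeadNumberBd z zb w ℓ c₁ c₂ (td ℓ k) (td ℓ (k + 1)) σlo σhi (nFo ℓ k)))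
    -- ODD (M_odd) box rows and (T_odd)
    (eo : ℕ → ℕ → ℝ) (Mo : ℕ → ℕ)
    (heo : ∀ j : ℕ, (j : ℝ) + τ < ET → eo j 0 ≤ max E₀ ((j : ℝ) + τ) ∧ ET ≤ eo j (Mo j))
    (hboxo : ∀ j : ℕ, (j : ℝ) + τ < ET → ∀ m < Mo j,
      0 ≤ cornerBound₂ (fun k => w 3 k - w 4 k - |w 2 k|) (fun k => w 3 k + w 4 k + |w 2 k|) z zb j
        (eo j m) (eo j (m + 1)) σlo σhi)
    (hc : 0 ≤ w 3 a₀ - w 4 a₀ - |w 2 a₀|)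
    (hTodd : apexRest (w 3) z zb a₀ qd qr σlo ET + apexRest (w 4) z zb a₀ qd qr σlo ET +
        apexRest (fun k => |w 2 k|) z zb a₀ qd qr σlo ET ≤
      (w 3 a₀ - w 4 a₀ - |w 2 a₀|) * ((1 - z a₀) * (1 - zb a₀)) ^ σhi) :
    BoxExcluded Q := by
  -- the (M) rows
  have hM := ruleM_even_of_boxTable z zb w hz hzb hQ ee Me hee hboxe
  have hModd := ruleM_odd_of_boxTable z zb w hz hzb hQ eo Mo heo hboxo
  -- even cells
  have hcelle' : ∀ ℓ, (ℓ = 0 ∨ (Even ℓ ∧ ℓ < L)) → ∀ k, k < Ke ℓ → ∀ p ∈ Q,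
      ∀ Δ ∈ Ico (te ℓ k) (te ℓ (k + 1)),
        (CrossingFunctional.ofPoints z zb w).EvenPositive p.1 p.2 Δ ℓ := by
    intro ℓ hℓ k hk
    rcases hcelle ℓ hℓ k hk with ⟨hlow, hτa, hX, hY, hZ⟩ | ⟨_, hba, hX, hY, hZ⟩
    · exact evenCell_of_headNumbers z zb w hz hzb hord a₀ qd qr hqd hqr hdomd hdomr hQ hM h0 h1 hX0
        hY0 hZ0 hlow hτa (nFe ℓ k) (hnFe ℓ k hk) hX hY hZ
    · exact evenCellM_of_headNumbers z zb w hz hzb hord a₀ qd qr hqd hqr hdomd hdomr hQ hM h0 h1 hX0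
        hY0 hZ0 hba (by linarith) (nFe ℓ k) (hnFe ℓ k hk) hX hY hZ
  have hb0 : unitarityBound3D 0 = 1 / 2 := by simp [unitarityBound3D]
  have hcellε' : ∀ k, k < Kε → ∀ p ∈ Q, ∀ Δ ∈ Ico (tε k) (tε (k + 1)),
      (CrossingFunctional.ofPoints z zb w).EvenPositive p.1 p.2 Δ 0 := by
    intro k hk
    obtain ⟨hX, hY, hZ⟩ := hcellε k hk
    refine evenCell_of_headNumbers z zb w hz hzb hord a₀ qd qr hqd hqr hdomd hdomr hQ hM h0 h1 hX0
      hY0 hZ0 (by rw [hb0]; exact (hlowε k hk).1) (by simpa using (hlowε k hk).2) (nFε k)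
      (hnFε k hk) hX hY hZ
  -- odd cells
  have hcello' : ∀ ℓ, ℓ < L → ∀ k, k < Ko ℓ → ∀ p ∈ Q, ∀ Δ ∈ Ico (td ℓ k) (td ℓ (k + 1)),
      (CrossingFunctional.ofPoints z zb w).OddPositive p.1 p.2 Δ ℓ := by
    intro ℓ hℓ k hk
    rcases hcello ℓ hℓ k hk with ⟨hlow, hτa, h0k, hnum⟩ | ⟨hℓ1, hba, hnum⟩
    · refine oddCell_of_headNumber z zb w hz hzb hord a₀ qd qr hqd hqr hdomd hdomr hQ hQc hModd hc
        hTodd hlow hτa ?_ (nFo ℓ k) (hnFo ℓ k hk) hnum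
      intro hℓ0
      subst hℓ0
      exact Or.inl (lt_of_lt_of_le htd0.2.2 h0k)
    · exact oddCellBd_of_headNumber z zb w hz hzb hord a₀ qd qr hqd hqr hdomd hdomr hQ hQc hModd hc
        hTodd hℓ1 hba (by linarith) (nFo ℓ k) (hnFo ℓ k hk) hnum
  have hcellσ' : ∀ k, k < Kσ → ∀ p ∈ Q, ∀ Δ ∈ Ico (tσ k) (tσ (k + 1)),
      (CrossingFunctional.ofPoints z zb w).OddPositive p.1 p.2 Δ 0 := by
    intro k hk
    refine oddCell_of_headNumber z zb w hz hzb hord a₀ qd qr hqd hqr hdomd hdomr hQ hQc hModd hc hTodd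
      (by rw [hb0]; exact (hlowσ k hk).1) (by simpa using (hlowσ k hk).2.1)
      (fun _ => Or.inr (hlowσ k hk).2.2) (nFσ k) (hnFσ k hk) (hcellσ k hk)
  have hL0 : 0 < L := by
    by_contra h
    have : L = 0 := by omega
    subst this
    simp at hL
    linarith
  refine boxExcluded_of_mixedPointRules₂ hz hzb hord a₀ qd qr hqd hqr hdomd hdomr hQ hτ1 hτ0 hE1 hI
    ?_ ?_ ?_ hM h0 h1 hX0 hY0 hZ0 ?_ ?_ ?_ hModd hc hTodd
  · -- (E2): `Δ_ε` lies in the ε-row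
    intro p hp
    exact evenPositive_of_cells z zb w tε Kε htε.1 le_rfl hcellε' p hp p.2 (hQ p hp).2.1
      (lt_of_le_of_lt (hQ p hp).2.2 htε.2)
  · -- (E3)
    intro p hp Δ h3 hΔ
    exact evenPositive_of_cells z zb w (te 0) (Ke 0) hte0.1 hte0.2.symm.le (hcelle' 0 (Or.inl rfl)) p hp
      Δ h3 hΔ
  · -- (E4)
    intro p hp ℓ hev hℓ Δ hℓΔ hΔ
    have hℓL : ℓ < L := by
      by_contra h
      have : (L : ℝ) ≤ ℓ := by exact_mod_cast not_lt.1 h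
      linarith
    obtain ⟨hlo, hhi⟩ := hteℓ ℓ hev hℓ hℓL
    exact evenPositive_of_cells z zb w (te ℓ) (Ke ℓ) hlo hhi.symm.le (hcelle' ℓ (Or.inr ⟨hev, hℓL⟩))
      p hp Δ hℓΔ hΔ
  · -- (D2): `Δ_σ` lies in the σ-row
    intro p hp
    exact oddPositive_of_cells z zb w tσ Kσ htσ.1 le_rfl hcellσ' p hp p.1 (hQ p hp).1.1
      (lt_of_le_of_lt (hQ p hp).1.2 htσ.2)
  · -- (D3)
    intro p hp Δ h3 hΔ
    exact oddPositive_of_cells z zb w (td 0) (Ko 0) htd0.1 htd0.2.1.symm.le (hcello' 0 hL0) p hp Δ h3 hΔ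
  · -- (D4)
    intro p hp ℓ hℓ Δ hℓΔ hΔ
    have hℓL : ℓ < L := by
      by_contra h
      have : (L : ℝ) ≤ ℓ := by exact_mod_cast not_lt.1 h
      linarith
    obtain ⟨hlo, hhi⟩ := htdℓ ℓ hℓ hℓL
    exact oddPositive_of_cells z zb w (td ℓ) (Ko ℓ) hlo hhi.symm.le (hcello' ℓ hℓL) p hp Δ hℓΔ hΔ

end Literature.MathematicalPhysics.QuantumFieldTheory.ConformalBootstrap3D
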